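import Summits.BirchSwinnertonDyer.BirchSwinnertonDyer.Theorems.SignedLowerHalvesKobayashiMainConjectureSmallImageTeichOrbitMu
import HarnessLib

/-!
# Route `SignedLowerHalves` (K3), crux L `SmallImageLowerHalfBothSigns` (item stmt-BirchSwinnertonDyer-23599), line
# `birth_acns` v14, stub `stub_muBothSigns_ns`: THE PARITY-PACKET ROAD — the second sign of Pollack's `μ`-conjecture
# at EVERY odd supersingular prime, in the tree's B⁰ vocabulary
# (cell `bsd-ssimc`, width seat `bsd-line-slh-p3-w2` gen 4; helper file `--supports 23599`; THEOREMS ONLY)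

HONEST FRAMING.  The registered stub `stub_muBothSigns_ns` («`μ(L_p⁺) = μ(L_p⁻) = 0` at every small-image
supersingular X7 pair», Pollack 2003 Conj. 6.3 / Perrin-Riou on an infinite class) is OPEN and is NOT proved here;
the verdict of record (`stub-misstated`, gens 0/2/3) stands.  Gens 2/3 typed the `p = 3` slice of the second sign
(two unit layers / PARITY-SPAN(3)) and left the `p ≥ 5` slice as «one sign ⟸ B⁰ `TeichSpanGenAll`; the second sign
needs a Teichmüller-averaged parity span — no vocabulary».  This file supplies that road WITHOUT a new definition, at
every odd `p` at once, in the vocabulary of `Theorems/SmallImageMuTransferAnalyticMuZeroX9TeichSpanDefs.lean`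
(`IsTeichPacket`, `iotaGamma0`, `bEntry`) and `Rank1Residual.IsGoodAt` / `trEntry`:

**PARITY-PACKET HYPOTHESIS at `(N, p, π)`** (displayed, never asserted; `π` a level parity): a set `S ⊆ Γ₀(N)` each of
whose members is a Teichmüller packet product at a level `n ≥ 1` with `n ≡ π (mod 2)`, or an element of finite order /
trace `±2`, or a `p`-th power, such that for every GOOD `γ` (`|d_γ| = pᵐ`) the `ι`-norm `γ·γ^ι` lies in
`⟨S⟩ · [Γ₀(N), Γ₀(N)]`.  Homologically (Manin 1972 Prop. 1.4): the plus parts `(1+ι){0 → b/pᵐ}` of ALL `p`-power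
winding classes lie in the `𝔽_p`-span of the averaged classes `A_n(u) = Σ_{η ∈ μ_{p−1}} {0 → ηu/pⁿ}` of ONE parity
`n ≡ π`.  Conjecture B⁰ (`TeichSpanGen N p`) is the parity-free case `S = teichSpanGenerators N p`.

* §1 `exists_norm_teichOrbitSum_eq_one_of_parityPackets` — LEVEL FORM, `a_p(f) = 0`: `f` a rational newform on
  `Γ₀(N)`, `p` odd, `p ∤ N`, an Eisenstein multiple `n₀{∞,0}_f ∈ Λ_f` prime to `p`, winding non-constancy mod `p`; the
  parity-packet hypothesis at `π` ⟹ a Teichmüller-orbit sum `S_f(p, n, u)` at some level `n ≥ 1`, `n ≡ π`, is a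
  `p`-adic UNIT.  Proof (contrapositive): all parity-`π` orbit sums `≡ 0` ⟹ `[0]⁺ ≡ 0` (level `1`: `S_f(p,1,·) =
  (a_p − 2)[0]⁺ = −2[0]⁺`; level `2`: `Σ_{b ↦ a} S_f(p,2,b) = a_p S_f(p,1,a) − (p−1)[0]⁺ = −(p−1)[0]⁺`, MTT (4.2)) ⟹
  Manin's homomorphism `γ ↦ m(γ)`, `m(γ)/2 = [γ·0]⁺ − [0]⁺`, kills every member of `S` mod `p` (a parity-`π` packet
  sums to `S_f(p,n,u) − (p−1)[0]⁺ ≡ 0`) and the commutators ⟹ it kills `γ·γ^ι`, `m(γ^ι) = m(γ)` ⟹ `[b/pᵐ]⁺ ≡ [0]⁺`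
  at every good `γ` ⟹ the winding function is constant mod `p` on the `p`-power cusps — contradiction.  At `a_p = 0`
  no Hecke recursion across levels is needed (the X9 dictionary's `c_n ≡ −[0]⁺` step): the three-term relation links
  levels of equal parity only, and `[0]⁺ ≡ 0` comes from the two bottom layers.
* Part 2 (`…MuRiderParityPacketsSigns.lean`, same namespace) — §2 CURVE FORM
  `exists_isSignedPAdicLFunction_hasUnitContent_of_parityPackets`: `W/ℚ` globally minimal, `p` odd of good reduction
  with `a_p = 0`, `f` its newform of level `N`: the parity-packet hypothesis at `(N, p, π)` gives
  `∃ L, IsSignedPAdicLFunction f p ε L ∧ HasUnitContent L` for `ε = 1` if `π` is ODD, `ε = −1` if `π` is EVEN (an orbit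
  sum at level `n+1` is a group-ring coefficient of `θ_n`; `E[p]` irreducible by Serre Prop. 12; winding non-constancy
  = THEOREM B, input-free); BOTH parities ⟹ the conclusion of `stub_muBothSigns_ns` AT THAT PAIR; §3 CLASS FORM
  `muBothSigns_of_parityPacketsAll` — the registered stub text VERBATIM from the parity-packet hypothesis at every odd
  prime `p`, every level `N` prime to `p` and both parities (class binders idle); `signedMuVanishing_of_parityPackets[All]`
  — the node `Supersingular.SignedMuVanishing W p`.

So the open content of the stub's second sign is, at every odd `p` uniformly, ONE elementary-generation statement per
parity — kit-testable per `(N, p, π)` exactly like the B⁰ census (61/61, `p ∈ {5,7}`, `N ≤ 1216`); at `p = 3` (where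
a packet is `{g, g'}` with `b' ≡ −b`, i.e. `A_n(u) = (1+ι){0 → u/3ⁿ}`) it is the PLUS PART of gen 3's PARITY-SPAN(3)
(`SpanModBy N 3 S_even/odd`; apply `1+ι` — not typed here).  Nothing here is asserted about any level or curve; BSD,
child L, crux 4 and the stub are NOT proved by any of this.

References: [Manin1972] Prop. 1.4; [MazurTateTeitelbaum1986Invent] §I.4 (4.2), §I.10 (10.1)–(10.2); [Pollack2003]
Thm. 5.6, Prop. 6.18, Conj. 6.3; [PollackWeston2011] Thm. 4.1 (1); [Serre1972] §1.11 Prop. 12; [Sun2007] §4.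
-/

-- D-0017: single-problem summit, the namespace repeats the problem name by design.
set_option linter.dupNamespace false
set_option autoImplicit false

noncomputable section

open scoped Classical MatrixGroups ModularForm

open Polynomial CongruenceSubgroup Matrix Matrix.SpecialLinearGroup
  Literature.NumberTheory.EllipticCurves Literature.NumberTheory.EllipticCurves.ModularForms
  Literature.NumberTheory.EllipticCurves.Kobayashi2003 Literature.NumberTheory.EllipticCurves.GreenbergVatsal2000
  Literature.NumberTheory.EllipticCurves.Rank1Residual

namespace Summit.BirchSwinnertonDyer.BirchSwinnertonDyer.Theorems.SmallImageLowerHalfBothSignsMuRiderParityPackets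

open Summit.BirchSwinnertonDyer.BirchSwinnertonDyer.Cruxes.AnalyticMuZeroX9.TeichSpan
open Summit.BirchSwinnertonDyer.BirchSwinnertonDyer.Theorems.CollapseThree
open Summit.BirchSwinnertonDyer.BirchSwinnertonDyer.Theorems.PrintX8VerticalStevens
open Summit.BirchSwinnertonDyer.BirchSwinnertonDyer.Theorems.SmallImageTeichOrbitMu
  (teichOrbitSum_eq_coeff_comp_mazurTateElement)
open Summit.BirchSwinnertonDyer.BirchSwinnertonDyer.Theorems.SmallImageOrbitSumMu
  (exists_isSignedPAdicLFunction_hasUnitContent_of_norm_coeff_eq_one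
    hasUnitContent_of_isSignedPAdicLFunction_of_norm_coeff_eq_one)

/-! ## §1 Level form: parity-`π` packets generate the `ι`-norms ⟹ a unit orbit sum at a parity-`π` level -/

section Level

variable {N : ℕ} [NeZero N] {f : CuspForm (Gamma0 N) 2} {p : ℕ} [Fact p.Prime]

/-- **The parity-packet dictionary, level form (`a_p = 0`).**  `f` a rational normalised newform on `Γ₀(N)`, `p` an
odd prime with `p ∤ N` and `a_p(f) = 0`, `n₀{∞,0}_f ∈ Λ_f` for some `n₀` prime to `p`, and the winding function
non-constant mod `p` on the `p`-power cusps.  IF some `S ⊆ Γ₀(N)` consists of Teichmüller packet products at levels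
`n ≥ 1` of parity `π`, finite-order / trace-`±2` elements and `p`-th powers, and `γ·γ^ι ∈ ⟨S⟩·[Γ₀(N),Γ₀(N)]` for every
good `γ`, THEN some Teichmüller-orbit sum `S_f(p, n, u)` (`u` a unit) at a level `n ≥ 1` with `n ≡ π (mod 2)` is a
`p`-adic unit.  Contrapositive: parity-`π` orbit sums `≡ 0` ⟹ `[0]⁺ ≡ 0` (levels `1`/`2`, MTT (4.2) at `a_p = 0`) ⟹
Manin's `m` kills `S` and the commutators ⟹ kills `γγ^ι` ⟹ `[b/pᵐ]⁺ ≡ [0]⁺` ⟹ winding function constant.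
[cite: Manin1972, Prop. 1.4] [cite: MazurTateTeitelbaum1986Invent, §I.4 (4.2), §I.10 (10.1)–(10.2)] -/
theorem exists_norm_teichOrbitSum_eq_one_of_parityPackets (hf : IsNewform0 f) (hQ : coeffField f = ⊥)
    (hp2 : p ≠ 2) (hpN : ¬ p ∣ N) (hap : cuspCoeff f p = ((0 : ℤ) : ℂ)) {n₀ : ℤ} (hpn₀ : ¬ (p : ℤ) ∣ n₀)
    (h0 : (n₀ : ℂ) * modularSymbol f 0 ∈ periodLattice f) (π : ℕ) {S : Set (Gamma0 N)}
    (hS : ∀ γ ∈ S, (∃ (n : ℕ) (l : List (Gamma0 N)), 1 ≤ n ∧ n % 2 = π % 2 ∧ IsTeichPacket N p n l ∧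
        γ = l.prod) ∨ (IsOfFinOrder γ ∨ trEntry γ = 2 ∨ trEntry γ = -2) ∨ ∃ h : Gamma0 N, γ = h ^ p)
    (hB : ∀ γ : Gamma0 N, IsGoodAt p γ → γ * iotaGamma0 γ ∈ Subgroup.closure S ⊔ commutator (Gamma0 N))
    (hw : ∃ (n : ℕ) (a a' : ℤ), 1 ≤ ‖((ratPlusSymbol f ((a : ℚ) / (p : ℚ) ^ n) -
      ratPlusSymbol f ((a' : ℚ) / (p : ℚ) ^ n) : ℚ) : ℚ_[p])‖) :
    ∃ n : ℕ, 1 ≤ n ∧ n % 2 = π % 2 ∧ ∃ u : (ZMod (p ^ n))ˣ,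
      ‖((teichOrbitSum f p n (u : ZMod (p ^ n)) : ℚ) : ℚ_[p])‖ = 1 := by
  classical
  have hp : p.Prime := Fact.out
  have hpZ : Prime (p : ℤ) := Nat.prime_iff_prime_int.mp hp
  -- period data (Manin 1972 / the period convention `re Λ_f = ℤ·Ω⁺/2`), as in the X9 dictionary
  have hreal : ∀ n, (cuspCoeff f n).im = 0 := cuspCoeff_im_eq_zero_of_coeffField_eq_bot hQ
  have hrat : ∀ r : ℚ, (ratPlusSymbol f r : ℝ) = normalizedPlusSymbol f r :=
    fun r ↦ ratCast_ratPlusSymbol_holds hf hQ r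
  have hΩpos : 0 < plusPeriod f := (plusPeriod_pos_and_realPeriods_eq isZLattice_periodLattice_holds hf hQ).1
  have hΩ : plusPeriod f ≠ 0 := hΩpos.ne'
  have hΩ2 : plusPeriod f / 2 ≠ 0 := div_ne_zero hΩ two_ne_zero
  obtain ⟨hre, -⟩ := realPeriods_eq_zmultiples_of_plusPeriod_ne_zero f hΩ
  choose m hm using exists_re_cuspSymbol_eq f hre
  have hm_zero : ∀ γ, cuspSymbol f γ = 0 → m γ = 0 := by
    intro γ hγ
    have h := hm γ
    rw [hγ, Complex.zero_re] at h
    exact_mod_cast (mul_eq_zero.mp h.symm).resolve_right hΩ2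
  have hm_mul : ∀ γ δ, m (γ * δ) = m γ + m δ := by
    intro γ δ
    have h2 : (cuspSymbol f (γ * δ)).re = (cuspSymbol f γ).re + (cuspSymbol f δ).re := by
      rw [cuspSymbol_mul_holds f γ δ, Complex.add_re]
    rw [hm, hm, hm, ← add_mul] at h2
    exact_mod_cast mul_right_cancel₀ hΩ2 h2
  have hm_one : m 1 = 0 := hm_zero 1 (cuspSymbol_one f)
  have hm_pow : ∀ (γ : Gamma0 N) (n : ℕ), m (γ ^ n) = n * m γ := by
    intro γ n
    induction n with
    | zero => simp [hm_one]
    | succ n ih => rw [pow_succ, hm_mul, ih]; push_cast; ring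
  -- Manin at `r = 0`: `[b/d]⁺ − [0]⁺ = m(γ)/2` for `γ = (a b; c d)`, `d ≠ 0`
  have hcusp : ∀ γ : Gamma0 N, dEntry γ ≠ 0 →
      ratPlusSymbol f (((bEntry γ : ℤ) : ℚ) / ((dEntry γ : ℤ) : ℚ)) - ratPlusSymbol f 0 = (m γ : ℚ) / 2 := by
    intro γ hd
    have hd' : ((γ : SL(2, ℤ)) 1 0 : ℚ) * 0 + ((γ : SL(2, ℤ)) 1 1 : ℚ) ≠ 0 := by
      rw [mul_zero, zero_add]; exact_mod_cast hd
    have h := ratCast_ratPlusSymbol_moebius_sub f hrat hreal γ 0 hd'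
    simp only [mul_zero, zero_add] at h
    rw [hm] at h
    have h' : ((ratPlusSymbol f (((bEntry γ : ℤ) : ℚ) / ((dEntry γ : ℤ) : ℚ)) - ratPlusSymbol f 0 : ℚ) : ℝ) =
        (((m γ : ℚ) / 2 : ℚ) : ℝ) := by
      push_cast
      rw [show ((bEntry γ : ℤ) : ℚ) = ((γ : SL(2, ℤ)) 0 1 : ℚ) from rfl,
        show ((dEntry γ : ℤ) : ℚ) = ((γ : SL(2, ℤ)) 1 1 : ℚ) from rfl, h]
      field_simp
    exact_mod_cast h'
  -- integrality of the symbols at the `p`-power cusps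
  have hint : ∀ (k n : ℕ), ‖((ratPlusSymbol f ((k : ℚ) / (p : ℚ) ^ n) : ℚ) : ℚ_[p])‖ ≤ 1 := by
    intro k n
    have hcop : Nat.Coprime (p ^ n) N := Nat.Coprime.pow_left n ((Nat.Prime.coprime_iff_not_dvd hp).mpr hpN)
    have hx := coprime_den_of_coprime (N := N) hcop (k : ℤ)
    rw [Int.cast_natCast, Nat.cast_pow] at hx
    exact norm_ratPlusSymbol_le_one f hp2 hpn₀ h0 hx
  have hint0 : ‖((ratPlusSymbol f 0 : ℚ) : ℚ_[p])‖ ≤ 1 := by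
    have h := hint 0 0
    rwa [Nat.cast_zero, zero_div] at h
  have hintS : ∀ (n : ℕ) (a : ZMod (p ^ n)), ‖((teichOrbitSum f p n a : ℚ) : ℚ_[p])‖ ≤ 1 :=
    norm_teichOrbitSum_le_one hint
  -- suppose, for contradiction, that NO parity-`π` orbit sum (level `≥ 1`, over a unit) is a unit: all are `≡ 0`
  by_contra H
  have Hlt : ∀ n : ℕ, 1 ≤ n → n % 2 = π % 2 → ∀ u : (ZMod (p ^ n))ˣ,
      ‖((teichOrbitSum f p n (u : ZMod (p ^ n)) : ℚ) : ℚ_[p])‖ < 1 := by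
    intro n hn hpar u
    exact lt_of_le_of_ne (hintS n u) fun h ↦ H ⟨n, hn, hpar, u, h⟩
  -- `‖2‖_p = 1` (`p` odd)
  have h2 : ‖((2 : ℤ) : ℚ_[p])‖ = 1 := by
    refine le_antisymm (Padic.norm_int_le_one 2) (not_lt.mp fun hlt ↦ ?_)
    rw [Padic.norm_intCast_lt_one_iff] at hlt
    have : (p : ℤ) ∣ 2 := hlt
    have hp2' : p ∣ 2 := by exact_mod_cast this
    exact hp2 ((Nat.prime_dvd_prime_iff_eq hp Nat.prime_two).mp hp2')
  -- Step 1: `[0]⁺ ≡ 0 (mod p)` — from level `1` (`π` odd) or level `2` (`π` even)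
  have h0lt : ‖((ratPlusSymbol f 0 : ℚ) : ℚ_[p])‖ < 1 := by
    rcases Nat.mod_two_eq_zero_or_one π with hπ | hπ
    · -- `π` even: `Σ_{b ↦ 1} S_f(p,2,b) = −(p−1)[0]⁺`, every `S_f(p,2,b) ≡ 0`
      have hH := intCast_mul_teichOrbitSum_one hf hpN hap hrat hp2 1
      have hp1 : ((p - 1 : ℕ) : ℚ) = (p : ℚ) - 1 := by
        rw [Nat.cast_sub hp.one_le, Nat.cast_one]
      have e : (ratPlusSymbol f 0 : ℚ) =
          (∑ b ∈ Finset.univ.filter (fun b : ZMod (p ^ (0 + 2)) ↦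
            ZMod.castHom (pow_dvd_pow p (0 + 1).le_succ) (ZMod (p ^ (0 + 1))) b = 1),
              teichOrbitSum f p (0 + 2) b) + (p : ℚ) * ratPlusSymbol f 0 := by
        rw [hp1] at hH; simp only [Int.cast_zero, zero_mul] at hH; linear_combination hH
      rw [e]
      push_cast
      refine padic_norm_add_lt_one (norm_sum_lt_one _ _ fun b hb ↦ ?_) (norm_natCast_mul_lt_one hint0)
      rw [Finset.mem_filter] at hb
      have hu : IsUnit b := isUnit_of_castHom_eq isUnit_one hb.2
      have h := Hlt (0 + 2) (by omega) (by omega) hu.unit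
      rwa [IsUnit.unit_spec] at h
    · -- `π` odd: `S_f(p,1,1) = (a_p − 2)[0]⁺ = −2[0]⁺ ≡ 0`
      have hS1 := teichOrbitSum_one_eq hf hpN hap hrat hp2 1
      have h1 := Hlt (0 + 1) (by omega) (by omega) 1
      rw [hS1] at h1
      push_cast at h1
      rw [zero_sub, neg_mul, norm_neg, norm_mul] at h1
      have h2' : ‖(2 : ℚ_[p])‖ = 1 := by exact_mod_cast h2
      rwa [h2', one_mul] at h1
  -- hence `(p − 1)[0]⁺ ≡ 0`
  have hp1lt : ‖(((p - 1 : ℕ) : ℚ_[p])) * ((ratPlusSymbol f 0 : ℚ) : ℚ_[p])‖ < 1 := by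
    rw [Nat.cast_sub hp.one_le, Nat.cast_one, sub_mul, one_mul]
    exact norm_sub_lt_one (norm_natCast_mul_lt_one hint0) h0lt
  -- Step 2: the reduction of `m` mod `p` as a homomorphism `Γ₀(N) → ℤ/p` kills `S` and the commutators
  let φ : Gamma0 N →* Multiplicative (ZMod p) :=
    { toFun := fun γ ↦ Multiplicative.ofAdd (((m γ : ℤ) : ZMod p))
      map_one' := by simp [hm_one]
      map_mul' := fun γ δ ↦ by simp [hm_mul, ofAdd_add] }
  have hφ : ∀ γ, φ γ = 1 ↔ (p : ℤ) ∣ m γ := by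
    intro γ
    simp [φ, ZMod.intCast_zmod_eq_zero_iff_dvd]
  have hker : Subgroup.closure S ⊔ commutator (Gamma0 N) ≤ φ.ker := by
    refine sup_le ?_ (Abelianization.commutator_subset_ker φ)
    rw [Subgroup.closure_le]
    intro γ hγS
    rcases hS γ hγS with ⟨n, l, hn, hpar, hl, rfl⟩ | hγ | ⟨h, rfl⟩
    · -- parity-`π` packet products: `Σ_g m(g)/2 = S(n,u) − (p−1)[0]⁺ ≡ 0`
      have hlnd : l.Nodup := hl.2.2.1.of_map _
      have hlen : l.length = p - 1 := hl.1
      obtain ⟨u, hu⟩ := exists_sum_packet_eq_teichOrbitSum (f := f) hp2 hn hl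
      rw [← List.sum_toFinset _ hlnd] at hu
      have hmsum : ((((l.map m).sum : ℤ) : ℚ) / 2 : ℚ) =
          teichOrbitSum f p n (u : ZMod (p ^ n)) - ((p - 1 : ℕ) : ℚ) * ratPlusSymbol f 0 := by
        rw [← hu, Int.cast_list_sum, List.map_map, ← List.sum_toFinset _ hlnd, Finset.sum_div,
          ← hlen, ← List.toFinset_card_of_nodup hlnd]
        rw [show ((l.toFinset.card : ℕ) : ℚ) * ratPlusSymbol f 0 = ∑ g ∈ l.toFinset, ratPlusSymbol f 0 by
          rw [Finset.sum_const, nsmul_eq_mul], ← Finset.sum_sub_distrib]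
        refine Finset.sum_congr rfl fun g hg ↦ ?_
        rw [List.mem_toFinset] at hg
        have hd := dEntry_eq_of_isTeichPacket hl hg
        have hd0 : dEntry g ≠ 0 := by rw [hd]; exact pow_ne_zero _ (by exact_mod_cast hp.ne_zero)
        rw [Function.comp_apply, ← hcusp g hd0, hd]
        push_cast
        rfl
      have hdvd : (p : ℤ) ∣ (l.map m).sum := by
        apply dvd_of_norm_div_two_lt_one hp2
        rw [hmsum]
        push_cast
        exact norm_sub_lt_one (Hlt n hn hpar u) hp1lt
      have hlist : l.map φ = (l.map fun g ↦ ((m g : ℤ) : ZMod p)).map Multiplicative.ofAdd := by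
        rw [List.map_map]; rfl
      have hcast : (l.map fun g ↦ ((m g : ℤ) : ZMod p)).sum = (((l.map m).sum : ℤ) : ZMod p) := by
        rw [Int.cast_list_sum, List.map_map]; rfl
      rw [SetLike.mem_coe, MonoidHom.mem_ker, φ.map_list_prod, hlist, ← ofAdd_list_prod, ofAdd_eq_one, hcast,
        ZMod.intCast_zmod_eq_zero_iff_dvd]
      exact hdvd
    · rw [SetLike.mem_coe, MonoidHom.mem_ker, hφ]
      rcases hγ with hfin | htr
      · exact ⟨0, by rw [hm_zero γ (cuspSymbol_eq_zero_of_isOfFinOrder f hfin), mul_zero]⟩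
      · exact ⟨0, by rw [hm_zero γ (cuspSymbol_eq_zero_of_trEntry f htr), mul_zero]⟩
    · -- `p`-th powers
      rw [SetLike.mem_coe, MonoidHom.mem_ker, hφ, hm_pow]
      exact ⟨m h, by ring⟩
  -- Step 3: for every good `γ`, `γ·γ^ι ∈ ker φ`, i.e. `p ∣ 2 m γ`, so `[b/d]⁺ ≡ [0]⁺`
  have hp2Z : ¬ (p : ℤ) ∣ 2 := fun h ↦
    hp2 ((Nat.prime_dvd_prime_iff_eq hp Nat.prime_two).mp (by exact_mod_cast h))
  have hgood : ∀ γ : Gamma0 N, IsGoodAt p γ →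
      ‖((ratPlusSymbol f (((bEntry γ : ℤ) : ℚ) / ((dEntry γ : ℤ) : ℚ)) - ratPlusSymbol f 0 : ℚ) : ℚ_[p])‖ < 1 := by
    intro γ hγ
    obtain ⟨e, he⟩ := hγ
    have hd0 : dEntry γ ≠ 0 := by
      intro h; rw [h, Int.natAbs_zero] at he; exact pow_ne_zero e hp.ne_zero he.symm
    have hι : m (iotaGamma0 γ) = m γ := by
      have h1 := hcusp (iotaGamma0 γ) (by rwa [dEntry_iotaGamma0])
      rw [bEntry_iotaGamma0, dEntry_iotaGamma0, Int.cast_neg, neg_div, ratPlusSymbol_neg f, hcusp γ hd0] at h1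
      have h2 : (m (iotaGamma0 γ) : ℚ) = m γ := by linarith
      exact_mod_cast h2
    have h2 : (p : ℤ) ∣ m (γ * iotaGamma0 γ) := (hφ _).mp (hker (hB γ ⟨e, he⟩))
    rw [hm_mul, hι, ← two_mul] at h2
    have hdvd : (p : ℤ) ∣ m γ := (hpZ.dvd_or_dvd h2).resolve_left hp2Z
    rw [hcusp γ hd0]
    exact norm_div_two_lt_one_of_dvd hp2 hdvd
  -- Step 4: every `p`-power cusp: `[b/p^k]⁺ ≡ [0]⁺`
  have hpNZ : ¬ (p : ℤ) ∣ (N : ℤ) := fun h ↦ hpN (by exact_mod_cast h)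
  have hall : ∀ (k : ℕ) (b : ℤ),
      ‖((ratPlusSymbol f ((b : ℚ) / (p : ℚ) ^ k) - ratPlusSymbol f 0 : ℚ) : ℚ_[p])‖ < 1 := by
    intro k
    induction k with
    | zero =>
      intro b
      rw [pow_zero, div_one, show (b : ℚ) = 0 + ((b : ℤ) : ℚ) by simp, ratPlusSymbol_add_intCast_eq, sub_self,
        Rat.cast_zero, norm_zero]
      exact zero_lt_one
    | succ k ih =>
      intro b
      by_cases hpb : (p : ℤ) ∣ b
      · obtain ⟨b', rfl⟩ := hpb
        have hpQ : (p : ℚ) ≠ 0 := Nat.cast_ne_zero.mpr hp.ne_zero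
        have e : (((p : ℤ) * b' : ℤ) : ℚ) / (p : ℚ) ^ (k + 1) = (b' : ℚ) / (p : ℚ) ^ k := by
          push_cast; rw [pow_succ]; field_simp
        rw [e]; exact ih b'
      · have hcop : IsCoprime ((p : ℤ) ^ (k + 1)) (b * N) :=
          IsCoprime.pow_left (IsCoprime.mul_right ((Prime.coprime_iff_not_dvd hpZ).mpr hpb)
            ((Prime.coprime_iff_not_dvd hpZ).mpr hpNZ))
        obtain ⟨x, y, hxy⟩ := hcop
        have hdet : Matrix.det !![x, b; -(y * N), (p : ℤ) ^ (k + 1)] = 1 := by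
          rw [Matrix.det_fin_two_of]; linear_combination hxy
        have hw0 : (((-(y * (N : ℤ)) : ℤ)) : ZMod N) = 0 := by push_cast; rw [ZMod.natCast_self]; ring
        have hmemN : (⟨!![x, b; -(y * N), (p : ℤ) ^ (k + 1)], hdet⟩ : SL(2, ℤ)) ∈ Gamma0 N :=
          Gamma0_mem.mpr (by simp [hw0])
        set γ₁ : Gamma0 N := ⟨⟨!![x, b; -(y * N), (p : ℤ) ^ (k + 1)], hdet⟩, hmemN⟩ with hγ₁
        have hb : bEntry γ₁ = b := rfl
        have hd : dEntry γ₁ = (p : ℤ) ^ (k + 1) := rfl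
        have hγgood : IsGoodAt p γ₁ := ⟨k + 1, by rw [hd, Int.natAbs_pow, Int.natAbs_natCast]⟩
        have h := hgood γ₁ hγgood
        rw [hb, hd] at h
        push_cast at h
        exact h
  -- Step 5: contradiction with the non-constancy of the winding function
  obtain ⟨n, a, a', hw⟩ := hw
  have h := norm_sub_lt_one (hall n a) (hall n a')
  rw [← Rat.cast_sub, show ratPlusSymbol f ((a : ℚ) / (p : ℚ) ^ n) - ratPlusSymbol f 0 -
      (ratPlusSymbol f ((a' : ℚ) / (p : ℚ) ^ n) - ratPlusSymbol f 0) =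
      ratPlusSymbol f ((a : ℚ) / (p : ℚ) ^ n) - ratPlusSymbol f ((a' : ℚ) / (p : ℚ) ^ n) by ring] at h
  exact absurd hw (not_le.mpr h)

end Level

end Summit.BirchSwinnertonDyer.BirchSwinnertonDyer.Theorems.SmallImageLowerHalfBothSignsMuRiderParityPackets

end
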